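import Summits.BirchSwinnertonDyer.BirchSwinnertonDyer.Theorems.ManinLocalTwoThreeManinOddAtFourTwinNormalForm
import Summits.BirchSwinnertonDyer.BirchSwinnertonDyer.Theorems.ManinLocalTwoThreeManinOddAtFourKatoShiftLever

/-!
# Route `ManinLocalTwoThree`, crux C2 `ManinOddAtFour` (stmt-BirchSwinnertonDyer-22967): the residual split along
# reductions to CLASS PREDICATES that may use the minimal model and the level (instances `[W.IsGloballyMinimal]`,
# `[NeZero N]`), and its instance at the sharpest landed reduction, seat p2's `χ₋₄`-TWIN NORMAL FORM (line prover p1,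
# lead integration step; helper)

Sequel to `…ManinOddAtFourGenericResidualSplit` (p592978/p593334), whose predicate `P : WeierstrassCurve ℚ → ℕ → Prop`
cannot mention `W.minimalDiscriminantInt` or parametrisation data at level `N` — which the clauses (iv)–(vi) of seat
p2's twist-orbit-minimal / twin-normal-form reductions do. Here `Q : ∀ W [W.IsElliptic] [W.IsGloballyMinimal] N
[NeZero N], Prop`; the four generic statements are re-proved verbatim for `Q` (`maninOddAtFour_of_classReduction_of_split`,
`…_of_classReduction_of_katoShift`, `…_of_classReduction_of_katoFact_of_generation`, `maninOddAtFour_iff_split_of_classReduction`),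
and instantiated: `maninOddAtFour_of_katoFact_of_generation_of_twinNormalResiduals` — **C2 BY NAME ⟸ F-es-21 ∧ E-es-22 ∧
(Ra, Rb on the twist-orbit-minimal classes in `χ₋₄`-twin normal form)** (`maninLocalTwoThree_maninOddAtFour_of_twinNormalForm`,
p591746, clauses (i)–(vi) verbatim; residual sizes 49 129 + 54 327 of the 897 670 optimal classes with `4 ∣ N < 5·10⁵`,
seat p2's census; the `W[2]`-irreducible `Δ < 0` part, 120 776 classes, is decided by F-es-21 ∧ E-es-22).
HONEST FRAMING: `proof.conditional`; F-es-21 statement-only, E-es-22 a conjecture (theorem-candidate via es MEMO §21),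
residuals open. Manin's conjecture at `2` is NOT proved here; nothing about BSD is proved here.
-/

set_option autoImplicit false
set_option linter.dupNamespace false

noncomputable section

open scoped Classical MatrixGroups ModularForm

open CongruenceSubgroup WeierstrassCurve Literature.NumberTheory.EllipticCurves
  Literature.NumberTheory.EllipticCurves.ModularForms
  Summit.BirchSwinnertonDyer.Rank1Residual.ManinAdditive

namespace Summit.BirchSwinnertonDyer.BirchSwinnertonDyer.Theorems.ManinLocalTwoThree

/-! ### Class predicates that may use the minimal model and the level structure

The predicates reached by seat p2's reductions (twist-orbit-minimal, twin normal form) mention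
`W.minimalDiscriminantInt` and parametrisation data at level `N`, i.e. they need the instances `[W.IsGloballyMinimal]`,
`[NeZero N]`; the generic split is restated for such predicates `Q` (same one-line proofs) and instantiated at the
sharpest landed reduction, the `χ₋₄`-TWIN NORMAL FORM (`maninLocalTwoThree_maninOddAtFour_of_twinNormalForm`, seat p2,
p591746; 224 232 of the 897 670 optimal classes with `4 ∣ N < 5·10⁵`: `W[2]`-irreducible `Δ < 0` 120 776 (decided),
Ra 49 129, Rb 54 327). -/

section ClassPredicate

variable (Q : ∀ (W : WeierstrassCurve ℚ) [W.IsElliptic] [W.IsGloballyMinimal] (N : ℕ) [NeZero N], Prop)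

/-- **Generic split of C2 along a reduction to a class predicate `Q`** (which may use the minimal model and the level):
certificate on the `W[2]`-irreducible data with `Q` ∧ archimedean residual on them ∧ Manin at `2` on the
`W[2]`-reducible data with `Q` ⟹ C2. [cite: Kato2004Asterisque, Thm. 9.7 (p. 189)] [cite: Stevens1989, Lemmas (5.2), (5.4)] -/
theorem maninOddAtFour_of_classReduction_of_split
    (hred : (Literature.NumberTheory.EllipticCurves.ModularForms.mazur_not_dvd_maninConstant_of_odd →
      Literature.NumberTheory.EllipticCurves.ModularForms.abbesUllmo_not_dvd_maninConstant_of_not_dvd_level →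
      Literature.NumberTheory.EllipticCurves.ModularForms.cesnavicius_not_two_dvd_maninConstant_of_two_dvd_level →
      Literature.NumberTheory.EllipticCurves.ModularForms.exists_isNewformOf →
      ∀ (W : WeierstrassCurve ℚ) [W.IsElliptic] [W.IsGloballyMinimal] {N : ℕ} [NeZero N]
        (D : ModularParametrizationData W N),
        (∀ z ∈ D.L.lattice, ∃ w ∈ periodLattice D.f, z = D.c * w) → 2 ^ 2 ∣ N → Q W N →
        ¬ (2 : ℤ) ∣ D.maninConstant) →
      Summit.BirchSwinnertonDyer.BirchSwinnertonDyer.Theses.ManinLocalTwoThree.ManinOddAtFour)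
    (hA : ∀ (W : WeierstrassCurve ℚ) [W.IsElliptic] [W.IsGloballyMinimal] {N : ℕ} [NeZero N]
      (D : ModularParametrizationData W N),
      (∀ z ∈ D.L.lattice, ∃ w ∈ periodLattice D.f, z = D.c * w) → 2 ^ 2 ∣ N →
      Q W N → W.HasIrreducibleModPGaloisRep 2 → ¬ (4 : ℤ) ∣ D.c ∧ (W.Δ < 0 → ¬ (2 : ℤ) ∣ D.c))
    (hRa : ∀ (W : WeierstrassCurve ℚ) [W.IsElliptic] [W.IsGloballyMinimal] {N : ℕ} [NeZero N]
      (D : ModularParametrizationData W N),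
      (∀ z ∈ D.L.lattice, ∃ w ∈ periodLattice D.f, z = D.c * w) → 2 ^ 2 ∣ N →
      Q W N → W.HasIrreducibleModPGaloisRep 2 → 0 < W.Δ → ¬ (4 : ℤ) ∣ D.c → ¬ (2 : ℤ) ∣ D.c)
    (hRb : ∀ (W : WeierstrassCurve ℚ) [W.IsElliptic] [W.IsGloballyMinimal] {N : ℕ} [NeZero N]
      (D : ModularParametrizationData W N),
      (∀ z ∈ D.L.lattice, ∃ w ∈ periodLattice D.f, z = D.c * w) → 2 ^ 2 ∣ N →
      Q W N → ¬ W.HasIrreducibleModPGaloisRep 2 → ¬ (2 : ℤ) ∣ D.c)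
    : Summit.BirchSwinnertonDyer.BirchSwinnertonDyer.Theses.ManinLocalTwoThree.ManinOddAtFour :=
  hred (fun _hM _hAU _hC _hnf W _ _ N _ D hopt h4 hQ => by
    show ¬ (2 : ℤ) ∣ D.c
    by_cases hirr : W.HasIrreducibleModPGaloisRep 2
    · obtain ⟨h4c, hneg⟩ := hA W D hopt h4 hQ hirr
      rcases lt_trichotomy W.Δ 0 with hlt | heq | hgt
      · exact hneg hlt
      · exact absurd heq W.isUnit_Δ.ne_zero
      · exact hRa W D hopt h4 hQ hirr hgt h4c
    · exact hRb W D hopt h4 hQ hirr)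

/-- **Generic split along a class-predicate reduction, certificate := E-es-21 `KatoShiftTwistManinTwo`.**
[cite: Kato2004Asterisque, Thm. 9.7 (p. 189)] -/
theorem maninOddAtFour_of_classReduction_of_katoShift
    (hred : (Literature.NumberTheory.EllipticCurves.ModularForms.mazur_not_dvd_maninConstant_of_odd →
      Literature.NumberTheory.EllipticCurves.ModularForms.abbesUllmo_not_dvd_maninConstant_of_not_dvd_level →
      Literature.NumberTheory.EllipticCurves.ModularForms.cesnavicius_not_two_dvd_maninConstant_of_two_dvd_level →
      Literature.NumberTheory.EllipticCurves.ModularForms.exists_isNewformOf →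
      ∀ (W : WeierstrassCurve ℚ) [W.IsElliptic] [W.IsGloballyMinimal] {N : ℕ} [NeZero N]
        (D : ModularParametrizationData W N),
        (∀ z ∈ D.L.lattice, ∃ w ∈ periodLattice D.f, z = D.c * w) → 2 ^ 2 ∣ N → Q W N →
        ¬ (2 : ℤ) ∣ D.maninConstant) →
      Summit.BirchSwinnertonDyer.BirchSwinnertonDyer.Theses.ManinLocalTwoThree.ManinOddAtFour)
    (hK2 : KatoShiftTwistManinTwo)
    (hRa : ∀ (W : WeierstrassCurve ℚ) [W.IsElliptic] [W.IsGloballyMinimal] {N : ℕ} [NeZero N]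
      (D : ModularParametrizationData W N),
      (∀ z ∈ D.L.lattice, ∃ w ∈ periodLattice D.f, z = D.c * w) → 2 ^ 2 ∣ N →
      Q W N → W.HasIrreducibleModPGaloisRep 2 → 0 < W.Δ → ¬ (4 : ℤ) ∣ D.c → ¬ (2 : ℤ) ∣ D.c)
    (hRb : ∀ (W : WeierstrassCurve ℚ) [W.IsElliptic] [W.IsGloballyMinimal] {N : ℕ} [NeZero N]
      (D : ModularParametrizationData W N),
      (∀ z ∈ D.L.lattice, ∃ w ∈ periodLattice D.f, z = D.c * w) → 2 ^ 2 ∣ N →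
      Q W N → ¬ W.HasIrreducibleModPGaloisRep 2 → ¬ (2 : ℤ) ∣ D.c)
    : Summit.BirchSwinnertonDyer.BirchSwinnertonDyer.Theses.ManinLocalTwoThree.ManinOddAtFour :=
  maninOddAtFour_of_classReduction_of_split Q hred (fun W _ _ _ _ D hopt h4 _ hirr => hK2 W D hopt h4 hirr) hRa hRb

/-- **Generic split along a class-predicate reduction, certificate := F-es-21 ∧ E-es-22.**
[cite: Kato2004Asterisque, Thm. 9.7 (p. 189)] -/
theorem maninOddAtFour_of_classReduction_of_katoFact_of_generation
    (hred : (Literature.NumberTheory.EllipticCurves.ModularForms.mazur_not_dvd_maninConstant_of_odd →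
      Literature.NumberTheory.EllipticCurves.ModularForms.abbesUllmo_not_dvd_maninConstant_of_not_dvd_level →
      Literature.NumberTheory.EllipticCurves.ModularForms.cesnavicius_not_two_dvd_maninConstant_of_two_dvd_level →
      Literature.NumberTheory.EllipticCurves.ModularForms.exists_isNewformOf →
      ∀ (W : WeierstrassCurve ℚ) [W.IsElliptic] [W.IsGloballyMinimal] {N : ℕ} [NeZero N]
        (D : ModularParametrizationData W N),
        (∀ z ∈ D.L.lattice, ∃ w ∈ periodLattice D.f, z = D.c * w) → 2 ^ 2 ∣ N → Q W N →
        ¬ (2 : ℤ) ∣ D.maninConstant) →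
      Summit.BirchSwinnertonDyer.BirchSwinnertonDyer.Theses.ManinLocalTwoThree.ManinOddAtFour)
    (hK : kato_neron_isIntegral_twistedSymbolSum_of_additive_two_polar) (hG : MultiShiftClassGenerationTwo)
    (hRa : ∀ (W : WeierstrassCurve ℚ) [W.IsElliptic] [W.IsGloballyMinimal] {N : ℕ} [NeZero N]
      (D : ModularParametrizationData W N),
      (∀ z ∈ D.L.lattice, ∃ w ∈ periodLattice D.f, z = D.c * w) → 2 ^ 2 ∣ N →
      Q W N → W.HasIrreducibleModPGaloisRep 2 → 0 < W.Δ → ¬ (4 : ℤ) ∣ D.c → ¬ (2 : ℤ) ∣ D.c)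
    (hRb : ∀ (W : WeierstrassCurve ℚ) [W.IsElliptic] [W.IsGloballyMinimal] {N : ℕ} [NeZero N]
      (D : ModularParametrizationData W N),
      (∀ z ∈ D.L.lattice, ∃ w ∈ periodLattice D.f, z = D.c * w) → 2 ^ 2 ∣ N →
      Q W N → ¬ W.HasIrreducibleModPGaloisRep 2 → ¬ (2 : ℤ) ∣ D.c)
    : Summit.BirchSwinnertonDyer.BirchSwinnertonDyer.Theses.ManinLocalTwoThree.ManinOddAtFour :=
  maninOddAtFour_of_classReduction_of_katoShift Q hred (katoShiftTwistManinTwo_of_katoFact_of_generation hK hG) hRa hRb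

/-- **Losslessness along a class-predicate reduction**: granted `PrintedSemistableManinFacts`, C2 ⟺ (certificate on the
irreducible data with `Q`) ∧ (archimedean residual with `Q`) ∧ (Manin at `2` on the reducible data with `Q`).
[cite: Stevens1989, Lemmas (5.2), (5.4)] -/
theorem maninOddAtFour_iff_split_of_classReduction (hPF : Summit.BirchSwinnertonDyer.BirchSwinnertonDyer.Theses.ManinLocalTwoThree.PrintedSemistableManinFacts)
    (hred : (Literature.NumberTheory.EllipticCurves.ModularForms.mazur_not_dvd_maninConstant_of_odd →
      Literature.NumberTheory.EllipticCurves.ModularForms.abbesUllmo_not_dvd_maninConstant_of_not_dvd_level →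
      Literature.NumberTheory.EllipticCurves.ModularForms.cesnavicius_not_two_dvd_maninConstant_of_two_dvd_level →
      Literature.NumberTheory.EllipticCurves.ModularForms.exists_isNewformOf →
      ∀ (W : WeierstrassCurve ℚ) [W.IsElliptic] [W.IsGloballyMinimal] {N : ℕ} [NeZero N]
        (D : ModularParametrizationData W N),
        (∀ z ∈ D.L.lattice, ∃ w ∈ periodLattice D.f, z = D.c * w) → 2 ^ 2 ∣ N → Q W N →
        ¬ (2 : ℤ) ∣ D.maninConstant) →
      Summit.BirchSwinnertonDyer.BirchSwinnertonDyer.Theses.ManinLocalTwoThree.ManinOddAtFour)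
    : Summit.BirchSwinnertonDyer.BirchSwinnertonDyer.Theses.ManinLocalTwoThree.ManinOddAtFour ↔
      ((∀ (W : WeierstrassCurve ℚ) [W.IsElliptic] [W.IsGloballyMinimal] {N : ℕ} [NeZero N]
        (D : ModularParametrizationData W N),
        (∀ z ∈ D.L.lattice, ∃ w ∈ periodLattice D.f, z = D.c * w) → 2 ^ 2 ∣ N → Q W N →
          W.HasIrreducibleModPGaloisRep 2 → ¬ (4 : ℤ) ∣ D.c ∧ (W.Δ < 0 → ¬ (2 : ℤ) ∣ D.c)) ∧
        (∀ (W : WeierstrassCurve ℚ) [W.IsElliptic] [W.IsGloballyMinimal] {N : ℕ} [NeZero N]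
        (D : ModularParametrizationData W N),
        (∀ z ∈ D.L.lattice, ∃ w ∈ periodLattice D.f, z = D.c * w) → 2 ^ 2 ∣ N → Q W N →
          W.HasIrreducibleModPGaloisRep 2 → 0 < W.Δ → ¬ (4 : ℤ) ∣ D.c → ¬ (2 : ℤ) ∣ D.c) ∧
        (∀ (W : WeierstrassCurve ℚ) [W.IsElliptic] [W.IsGloballyMinimal] {N : ℕ} [NeZero N]
        (D : ModularParametrizationData W N),
        (∀ z ∈ D.L.lattice, ∃ w ∈ periodLattice D.f, z = D.c * w) → 2 ^ 2 ∣ N → Q W N →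
          ¬ W.HasIrreducibleModPGaloisRep 2 → ¬ (2 : ℤ) ∣ D.c)) := by
  obtain ⟨hM, hAU, hC, hnf⟩ := hPF
  refine ⟨fun h2 => ⟨?_, ?_, ?_⟩, fun h => maninOddAtFour_of_classReduction_of_split Q hred h.1 h.2.1 h.2.2⟩
  · intro W _ _ N _ D hopt h4 _ _
    have h : ¬ (2 : ℤ) ∣ D.c := h2 hM hAU hC hnf W D hopt h4
    exact ⟨fun h4c => h (dvd_trans ⟨2, by norm_num⟩ h4c), fun _ => h⟩
  · intro W _ _ N _ D hopt h4 _ _ _ _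
    exact h2 hM hAU hC hnf W D hopt h4
  · intro W _ _ N _ D hopt h4 _ _
    exact h2 hM hAU hC hnf W D hopt h4

end ClassPredicate

section TwinNormalForm

/-- **C2 ⟸ the `p = 2` Kato fact F-es-21 ∧ the multi-shift generation law E-es-22 ∧ (both residuals on the twist-orbit-
minimal classes in `χ₋₄`-TWIN NORMAL FORM)** — instance of `maninOddAtFour_of_classReduction_of_katoFact_of_generation`
at seat p2's `maninLocalTwoThree_maninOddAtFour_of_twinNormalForm` (clauses (i)–(vi) verbatim): the residual leaves are
needed only on 49 129 (`Δ > 0`, `W[2]` irreducible) + 54 327 (`W[2]` reducible) of the 897 670 optimal classes with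
`4 ∣ N < 5·10⁵` (seat p2's census). A `proof.conditional`. [cite: Stevens1989, Lemmas (5.2), (5.4)]
[cite: Pal2012, Prop. 2.4, Lemma 3.1] [cite: Kato2004Asterisque, Thm. 9.7 (p. 189)] -/
theorem maninOddAtFour_of_katoFact_of_generation_of_twinNormalResiduals
    (hK : kato_neron_isIntegral_twistedSymbolSum_of_additive_two_polar) (hG : MultiShiftClassGenerationTwo)
    (hRa : ∀ (W : WeierstrassCurve ℚ) [W.IsElliptic] [W.IsGloballyMinimal] {N : ℕ} [NeZero N]
      (D : ModularParametrizationData W N),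
      (∀ z ∈ D.L.lattice, ∃ w ∈ periodLattice D.f, z = D.c * w) → 2 ^ 2 ∣ N →
      ¬ (∃ (W' : WeierstrassCurve ℚ) (d : ℤ), W'.IsElliptic ∧ W'.IsGloballyMinimal ∧
        (d = -1 ∨ d = 2 ∨ d = -2) ∧ IsIsogenous W (W'.quadraticTwist (d : ℚ)) ∧
        ¬ 2 ^ 2 ∣ W'.conductorNorm ℤ) →
      ¬ (∃ (W' : WeierstrassCurve ℚ) (q : ℕ), W'.IsElliptic ∧ W'.IsGloballyMinimal ∧
        q.Prime ∧ q ≠ 2 ∧ q ^ 2 ∣ N ∧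
        IsIsogenous W (W'.quadraticTwist (((-1 : ℤ) ^ (q / 2) * q : ℤ) : ℚ)) ∧
        ¬ q ^ 2 ∣ W'.conductorNorm ℤ) →
      ¬ (∃ (A : WeierstrassCurve ℚ), A.IsElliptic ∧ A.IsGloballyMinimal ∧ 2 ^ 4 ∣ N ∧
        2 ^ 2 ∣ A.conductorNorm ℤ ∧ A.conductorNorm ℤ ∣ N ∧ A.conductorNorm ℤ < N ∧
        IsIsogenous W (A.quadraticTwist ((-1 : ℤ) : ℚ))) →
      ¬ (∃ (A : WeierstrassCurve ℚ) (_ : A.IsElliptic) (_ : A.IsGloballyMinimal) (N' : ℕ) (_ : NeZero N')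
        (D' : ModularParametrizationData A N') (d : ℤ) (C : WeierstrassCurve ℚ) (u : VariableChange ℚ),
        C.IsElliptic ∧ C.IsGloballyMinimal ∧
        (∀ z ∈ D'.L.lattice, ∃ w ∈ periodLattice D'.f, z = D'.c * w) ∧ (d = 2 ∨ d = -2) ∧ 2 ^ 6 ∣ N ∧
        2 ^ 2 ∣ A.conductorNorm ℤ ∧ A.conductorNorm ℤ ∣ N ∧
        IsIsogenous W (A.quadraticTwist (d : ℚ)) ∧ u • A.quadraticTwist (d : ℚ) = C ∧
        C.Δ = (d : ℚ) ^ 6 * A.Δ ∧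
        (A.conductorNorm ℤ < N ∨ A.minimalDiscriminantInt.natAbs < W.minimalDiscriminantInt.natAbs)) →
      ¬ (∃ (A : WeierstrassCurve ℚ) (_ : A.IsElliptic) (_ : A.IsGloballyMinimal)
        (D' : ModularParametrizationData A N) (q : ℕ) (C : WeierstrassCurve ℚ) (u : VariableChange ℚ),
        C.IsElliptic ∧ C.IsGloballyMinimal ∧
        (∀ z ∈ D'.L.lattice, ∃ w ∈ periodLattice D'.f, z = D'.c * w) ∧ q.Prime ∧ q ≠ 2 ∧ q ^ 2 ∣ N ∧
        IsIsogenous C W ∧ u • A.quadraticTwist (((-1 : ℤ) ^ (q / 2) * q : ℤ) : ℚ) = C ∧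
        C.Δ = ((((-1 : ℤ) ^ (q / 2) * q : ℤ)) : ℚ) ^ 6 * A.Δ ∧
        A.minimalDiscriminantInt.natAbs < W.minimalDiscriminantInt.natAbs) →
      ¬ (W.c₆ < 0 ∧ ∃ (A : WeierstrassCurve ℚ) (_ : A.IsElliptic) (_ : A.IsGloballyMinimal)
        (D' : ModularParametrizationData A N),
        (∀ z ∈ D'.L.lattice, ∃ w ∈ periodLattice D'.f, z = D'.c * w) ∧ 2 ^ 4 ∣ N ∧
        2 ^ 2 ∣ A.conductorNorm ℤ ∧ IsIsogenous W (A.quadraticTwist ((-1 : ℤ) : ℚ)) ∧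
        A.minimalDiscriminantInt.natAbs ≤ W.minimalDiscriminantInt.natAbs ∧ 0 < A.c₆) →
      W.HasIrreducibleModPGaloisRep 2 → 0 < W.Δ → ¬ (4 : ℤ) ∣ D.c → ¬ (2 : ℤ) ∣ D.c)
    (hRb : ∀ (W : WeierstrassCurve ℚ) [W.IsElliptic] [W.IsGloballyMinimal] {N : ℕ} [NeZero N]
      (D : ModularParametrizationData W N),
      (∀ z ∈ D.L.lattice, ∃ w ∈ periodLattice D.f, z = D.c * w) → 2 ^ 2 ∣ N →
      ¬ (∃ (W' : WeierstrassCurve ℚ) (d : ℤ), W'.IsElliptic ∧ W'.IsGloballyMinimal ∧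
        (d = -1 ∨ d = 2 ∨ d = -2) ∧ IsIsogenous W (W'.quadraticTwist (d : ℚ)) ∧
        ¬ 2 ^ 2 ∣ W'.conductorNorm ℤ) →
      ¬ (∃ (W' : WeierstrassCurve ℚ) (q : ℕ), W'.IsElliptic ∧ W'.IsGloballyMinimal ∧
        q.Prime ∧ q ≠ 2 ∧ q ^ 2 ∣ N ∧
        IsIsogenous W (W'.quadraticTwist (((-1 : ℤ) ^ (q / 2) * q : ℤ) : ℚ)) ∧
        ¬ q ^ 2 ∣ W'.conductorNorm ℤ) →
      ¬ (∃ (A : WeierstrassCurve ℚ), A.IsElliptic ∧ A.IsGloballyMinimal ∧ 2 ^ 4 ∣ N ∧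
        2 ^ 2 ∣ A.conductorNorm ℤ ∧ A.conductorNorm ℤ ∣ N ∧ A.conductorNorm ℤ < N ∧
        IsIsogenous W (A.quadraticTwist ((-1 : ℤ) : ℚ))) →
      ¬ (∃ (A : WeierstrassCurve ℚ) (_ : A.IsElliptic) (_ : A.IsGloballyMinimal) (N' : ℕ) (_ : NeZero N')
        (D' : ModularParametrizationData A N') (d : ℤ) (C : WeierstrassCurve ℚ) (u : VariableChange ℚ),
        C.IsElliptic ∧ C.IsGloballyMinimal ∧
        (∀ z ∈ D'.L.lattice, ∃ w ∈ periodLattice D'.f, z = D'.c * w) ∧ (d = 2 ∨ d = -2) ∧ 2 ^ 6 ∣ N ∧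
        2 ^ 2 ∣ A.conductorNorm ℤ ∧ A.conductorNorm ℤ ∣ N ∧
        IsIsogenous W (A.quadraticTwist (d : ℚ)) ∧ u • A.quadraticTwist (d : ℚ) = C ∧
        C.Δ = (d : ℚ) ^ 6 * A.Δ ∧
        (A.conductorNorm ℤ < N ∨ A.minimalDiscriminantInt.natAbs < W.minimalDiscriminantInt.natAbs)) →
      ¬ (∃ (A : WeierstrassCurve ℚ) (_ : A.IsElliptic) (_ : A.IsGloballyMinimal)
        (D' : ModularParametrizationData A N) (q : ℕ) (C : WeierstrassCurve ℚ) (u : VariableChange ℚ),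
        C.IsElliptic ∧ C.IsGloballyMinimal ∧
        (∀ z ∈ D'.L.lattice, ∃ w ∈ periodLattice D'.f, z = D'.c * w) ∧ q.Prime ∧ q ≠ 2 ∧ q ^ 2 ∣ N ∧
        IsIsogenous C W ∧ u • A.quadraticTwist (((-1 : ℤ) ^ (q / 2) * q : ℤ) : ℚ) = C ∧
        C.Δ = ((((-1 : ℤ) ^ (q / 2) * q : ℤ)) : ℚ) ^ 6 * A.Δ ∧
        A.minimalDiscriminantInt.natAbs < W.minimalDiscriminantInt.natAbs) →
      ¬ (W.c₆ < 0 ∧ ∃ (A : WeierstrassCurve ℚ) (_ : A.IsElliptic) (_ : A.IsGloballyMinimal)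
        (D' : ModularParametrizationData A N),
        (∀ z ∈ D'.L.lattice, ∃ w ∈ periodLattice D'.f, z = D'.c * w) ∧ 2 ^ 4 ∣ N ∧
        2 ^ 2 ∣ A.conductorNorm ℤ ∧ IsIsogenous W (A.quadraticTwist ((-1 : ℤ) : ℚ)) ∧
        A.minimalDiscriminantInt.natAbs ≤ W.minimalDiscriminantInt.natAbs ∧ 0 < A.c₆) →
      ¬ W.HasIrreducibleModPGaloisRep 2 → ¬ (2 : ℤ) ∣ D.c)
    : Summit.BirchSwinnertonDyer.BirchSwinnertonDyer.Theses.ManinLocalTwoThree.ManinOddAtFour :=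
  maninOddAtFour_of_classReduction_of_katoFact_of_generation
    (fun (W : WeierstrassCurve ℚ) [W.IsElliptic] [W.IsGloballyMinimal] (N : ℕ) [NeZero N] =>
        (¬ (∃ (W' : WeierstrassCurve ℚ) (d : ℤ), W'.IsElliptic ∧ W'.IsGloballyMinimal ∧
        (d = -1 ∨ d = 2 ∨ d = -2) ∧ IsIsogenous W (W'.quadraticTwist (d : ℚ)) ∧
        ¬ 2 ^ 2 ∣ W'.conductorNorm ℤ)) ∧
        (¬ (∃ (W' : WeierstrassCurve ℚ) (q : ℕ), W'.IsElliptic ∧ W'.IsGloballyMinimal ∧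
        q.Prime ∧ q ≠ 2 ∧ q ^ 2 ∣ N ∧
        IsIsogenous W (W'.quadraticTwist (((-1 : ℤ) ^ (q / 2) * q : ℤ) : ℚ)) ∧
        ¬ q ^ 2 ∣ W'.conductorNorm ℤ)) ∧
        (¬ (∃ (A : WeierstrassCurve ℚ), A.IsElliptic ∧ A.IsGloballyMinimal ∧ 2 ^ 4 ∣ N ∧
        2 ^ 2 ∣ A.conductorNorm ℤ ∧ A.conductorNorm ℤ ∣ N ∧ A.conductorNorm ℤ < N ∧
        IsIsogenous W (A.quadraticTwist ((-1 : ℤ) : ℚ)))) ∧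
        (¬ (∃ (A : WeierstrassCurve ℚ) (_ : A.IsElliptic) (_ : A.IsGloballyMinimal) (N' : ℕ) (_ : NeZero N')
        (D' : ModularParametrizationData A N') (d : ℤ) (C : WeierstrassCurve ℚ) (u : VariableChange ℚ),
        C.IsElliptic ∧ C.IsGloballyMinimal ∧
        (∀ z ∈ D'.L.lattice, ∃ w ∈ periodLattice D'.f, z = D'.c * w) ∧ (d = 2 ∨ d = -2) ∧ 2 ^ 6 ∣ N ∧
        2 ^ 2 ∣ A.conductorNorm ℤ ∧ A.conductorNorm ℤ ∣ N ∧
        IsIsogenous W (A.quadraticTwist (d : ℚ)) ∧ u • A.quadraticTwist (d : ℚ) = C ∧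
        C.Δ = (d : ℚ) ^ 6 * A.Δ ∧
        (A.conductorNorm ℤ < N ∨ A.minimalDiscriminantInt.natAbs < W.minimalDiscriminantInt.natAbs))) ∧
        (¬ (∃ (A : WeierstrassCurve ℚ) (_ : A.IsElliptic) (_ : A.IsGloballyMinimal)
        (D' : ModularParametrizationData A N) (q : ℕ) (C : WeierstrassCurve ℚ) (u : VariableChange ℚ),
        C.IsElliptic ∧ C.IsGloballyMinimal ∧
        (∀ z ∈ D'.L.lattice, ∃ w ∈ periodLattice D'.f, z = D'.c * w) ∧ q.Prime ∧ q ≠ 2 ∧ q ^ 2 ∣ N ∧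
        IsIsogenous C W ∧ u • A.quadraticTwist (((-1 : ℤ) ^ (q / 2) * q : ℤ) : ℚ) = C ∧
        C.Δ = ((((-1 : ℤ) ^ (q / 2) * q : ℤ)) : ℚ) ^ 6 * A.Δ ∧
        A.minimalDiscriminantInt.natAbs < W.minimalDiscriminantInt.natAbs)) ∧
        (¬ (W.c₆ < 0 ∧ ∃ (A : WeierstrassCurve ℚ) (_ : A.IsElliptic) (_ : A.IsGloballyMinimal)
        (D' : ModularParametrizationData A N),
        (∀ z ∈ D'.L.lattice, ∃ w ∈ periodLattice D'.f, z = D'.c * w) ∧ 2 ^ 4 ∣ N ∧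
        2 ^ 2 ∣ A.conductorNorm ℤ ∧ IsIsogenous W (A.quadraticTwist ((-1 : ℤ) : ℚ)) ∧
        A.minimalDiscriminantInt.natAbs ≤ W.minimalDiscriminantInt.natAbs ∧ 0 < A.c₆)))
    (fun H' => maninLocalTwoThree_maninOddAtFour_of_twinNormalForm
      (fun hM hAU hC hnf W _ _ _ _ D hopt h4 c1 c2 c3 c4 c5 c6 =>
        H' hM hAU hC hnf W D hopt h4 ⟨c1, c2, c3, c4, c5, c6⟩))
    hK hG
    (fun W _ _ _ _ D hopt h4 hQ => hRa W D hopt h4 hQ.1 hQ.2.1 hQ.2.2.1 hQ.2.2.2.1 hQ.2.2.2.2.1 hQ.2.2.2.2.2)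
    (fun W _ _ _ _ D hopt h4 hQ => hRb W D hopt h4 hQ.1 hQ.2.1 hQ.2.2.1 hQ.2.2.2.1 hQ.2.2.2.2.1 hQ.2.2.2.2.2)

end TwinNormalForm

end Summit.BirchSwinnertonDyer.BirchSwinnertonDyer.Theorems.ManinLocalTwoThree

end
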